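import Summits.AnomalousDissipation.AnomalousDissipation.Theorems.QuasiStaticSolenoidalCellTensorQ.Negative.Exchange
import Summits.AnomalousDissipation.AnomalousDissipation.Theorems.SolenoidalFractalHomogenisationRealisedQuasiStaticCellLawIsotropicGainScale
import HarnessLib

/-!
# Negative side of K2Q `QuasiStaticSolenoidalCellTensorQ` (stmt-AnomalousDissipation-19072): the isotropy of a word design in
# Leray-projection form, for a complex slow vector (helper, `--supports stmt-AnomalousDissipation-19072`)

Summits-side helper file (everything proved; no definitions, no named facts).  The Taylor drain density of the window floor
lemma carries the polarisation factors `‖Π_{m_j} b‖²` of the principal Galerkin vector `b ∈ ℂ³`, `b ⊥ ℓ`; the design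
hypothesis `IsotropicWordGain W c₀` speaks of `slotGain` on REAL unit polarisations.  This file bridges the two:
* `norm_sq_leraySym_eq` — `‖Π_k w‖² = ‖w‖² − ‖k·w‖²/|k|²`; `leraySym_complexify` — `Π_m` of a real vector is real;
* `norm_sq_complexify_add_I_smul` — `‖u + i v‖² = ‖u‖² + ‖v‖²` for real `u, v`;
* `slotGain_eq_proj` — for real `p ⊥ q`, `slotGain P q p = τ·(ê·q)²·‖Π_m p‖²/(2(2π|m|)⁴)` (with
  `isotropicWordGain_norm_sq`: `Σ_j slotGain_j(q, p) = c₀·period·‖p‖²` for every real `p ⊥ q`);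
* `isotropic_proj_sum` — for every complex `b` with `ℓ·b = 0`:
  `Σ_j τ_j (ê_j·ℓ)² ‖Π_{m_j} b‖² /(2(2π|m_j|)⁴) = c₀ · period · |ℓ|² · ‖b‖²`.
This is NOT a proof of anomalous dissipation, and by itself not of `¬ K2Q`.
-/

set_option linter.dupNamespace false

noncomputable section

namespace Summit.AnomalousDissipation.AnomalousDissipation.Theorems.QuasiStaticSolenoidalCellTensorQ.Negative

open Set Function Complex
open scoped InnerProductSpace ComplexConjugate BigOperators
open Literature.Analysis Literature.Analysis.FunctionSpaces Literature.Analysis.FunctionSpaces.Torus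
open Literature.Analysis.FluidPDE Literature.Analysis.FluidPDE.LatticeShear
open Summit.AnomalousDissipation.AnomalousDissipation.Theorems.SolenoidalFractalHomogenisation.RealisedQuasiStaticCellLaw

variable {k₀ : ℕ}

/-! ## §1 The Leray symbol: norm identity and real vectors -/

/-- **`‖Π_k w‖² = ‖w‖² − ‖Σ kᵢwᵢ‖²/|k|²`** for `k ≠ 0`. -/
theorem norm_sq_leraySym_eq {k : Fin 3 → ℤ} (hk : k ≠ 0) (w : EuclideanSpace ℂ (Fin 3)) :
    ‖Torus.leraySym k w‖ ^ 2 = ‖w‖ ^ 2 - ‖∑ i, (k i : ℂ) * w i‖ ^ 2 / freqNormSq k := by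
  have hq0 : 0 < freqNormSq k := lt_of_lt_of_le one_pos (one_le_freqNormSq_of_ne_zero hk)
  have hq : ((freqNormSq k : ℝ) : ℂ) ≠ 0 := by exact_mod_cast hq0.ne'
  set lam : ℂ := (∑ i, (k i : ℂ) * w i) / ((freqNormSq k : ℝ) : ℂ) with hlam
  have hdec : w = Torus.leraySym k w + lam • Torus.freqVec k := by
    rw [Torus.leraySym_def, hlam, sub_add_cancel]
  have horth : inner ℂ (Torus.leraySym k w) (lam • Torus.freqVec k) = 0 := by
    rw [inner_smul_right, Torus.inner_freqVec_right, Torus.sum_mul_leraySym_apply, map_zero, mul_zero]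
  have hsq : ‖w‖ ^ 2 = ‖Torus.leraySym k w‖ ^ 2 + ‖lam • Torus.freqVec k‖ ^ 2 := by
    conv_lhs => rw [hdec]
    rw [@norm_add_sq ℂ, horth, map_zero, mul_zero, add_zero]
  have hfv : ‖Torus.freqVec k‖ ^ 2 = freqNormSq k := by
    rw [EuclideanSpace.norm_sq_eq, freqNormSq]
    refine Finset.sum_congr rfl fun i _ => ?_
    rw [Torus.freqVec_apply, Complex.norm_intCast]
    simp
  have hl : ‖lam • Torus.freqVec k‖ ^ 2 = ‖∑ i, (k i : ℂ) * w i‖ ^ 2 / freqNormSq k := by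
    rw [norm_smul, mul_pow, hfv, hlam, norm_div, Complex.norm_real, Real.norm_eq_abs, abs_of_pos hq0]
    field_simp
  rw [hsq, hl]
  ring

/-- **The Leray symbol of a real vector is real**: `Π_m (complexify p) = complexify (p − (m·p/|m|²) m)`. -/
theorem leraySym_complexify (m : Fin 3 → ℤ) (p : EuclideanSpace ℝ (Fin 3)) :
    Torus.leraySym m (EuclideanSpace.complexify p) =
      EuclideanSpace.complexify (p - ((∑ i, (m i : ℝ) * p i) / freqNormSq m) • latticeVec m) := by
  ext i
  rw [Torus.leraySym_def]
  simp only [PiLp.sub_apply, PiLp.smul_apply, smul_eq_mul, EuclideanSpace.complexify_apply, Torus.freqVec_apply,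
    latticeVec_apply]
  push_cast
  rfl

/-- **`‖complexify u + I • complexify v‖² = ‖u‖² + ‖v‖²`** for real vectors `u, v`. -/
theorem norm_sq_complexify_add_I_smul (u v : EuclideanSpace ℝ (Fin 3)) :
    ‖EuclideanSpace.complexify u + Complex.I • EuclideanSpace.complexify v‖ ^ 2 = ‖u‖ ^ 2 + ‖v‖ ^ 2 := by
  rw [EuclideanSpace.norm_sq_eq, EuclideanSpace.norm_sq_eq, EuclideanSpace.norm_sq_eq, ← Finset.sum_add_distrib]
  refine Finset.sum_congr rfl fun i _ => ?_
  simp only [PiLp.add_apply, PiLp.smul_apply, smul_eq_mul, EuclideanSpace.complexify_apply, Real.norm_eq_abs, sq_abs]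
  rw [show Complex.I * (v i : ℂ) = (v i : ℂ) * Complex.I by ring, Complex.norm_add_mul_I,
    Real.sq_sqrt (by positivity)]

/-- A complex vector splits into real and imaginary coordinate parts: `b = complexify (Re b) + I • complexify (Im b)`. -/
theorem eq_complexify_re_add_im (b : EuclideanSpace ℂ (Fin 3)) :
    b = EuclideanSpace.complexify (WithLp.toLp 2 fun i => (b i).re) +
      Complex.I • EuclideanSpace.complexify (WithLp.toLp 2 fun i => (b i).im) := by
  ext i
  simp only [PiLp.add_apply, PiLp.smul_apply, smul_eq_mul, EuclideanSpace.complexify_apply]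
  rw [mul_comm]
  exact (Complex.re_add_im (b i)).symm

/-- **The squared Leray norm of a complex vector splits over its real and imaginary parts.** -/
theorem norm_sq_leraySym_re_add_im (m : Fin 3 → ℤ) (b : EuclideanSpace ℂ (Fin 3)) :
    ‖Torus.leraySym m b‖ ^ 2 =
      ‖Torus.leraySym m (EuclideanSpace.complexify (WithLp.toLp 2 fun i => (b i).re))‖ ^ 2 +
        ‖Torus.leraySym m (EuclideanSpace.complexify (WithLp.toLp 2 fun i => (b i).im))‖ ^ 2 := by
  conv_lhs => rw [eq_complexify_re_add_im b]
  rw [Torus.leraySym_add, Torus.leraySym_smul, leraySym_complexify, leraySym_complexify, norm_sq_complexify_add_I_smul,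
    EuclideanSpace.norm_complexify, EuclideanSpace.norm_complexify]

/-! ## §2 `slotGain` in projection form and its homogeneity -/

/-- For a real `p` and `m ≠ 0`: `‖Π_m (complexify p)‖² = ‖p‖² − ⟪p, m̂⟫²`, `m̂ = m/|m|`. -/
theorem norm_sq_leraySym_complexify {m : Fin 3 → ℤ} (hm : m ≠ 0) (p : EuclideanSpace ℝ (Fin 3)) :
    ‖Torus.leraySym m (EuclideanSpace.complexify p)‖ ^ 2 =
      ‖p‖ ^ 2 - ⟪p, (1 / ‖latticeVec m‖) • latticeVec m⟫_ℝ ^ 2 := by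
  rw [norm_sq_leraySym_eq hm, EuclideanSpace.norm_complexify]
  have hsum : ∑ i, (m i : ℂ) * (EuclideanSpace.complexify p) i = ((∑ i, (m i : ℝ) * p i : ℝ) : ℂ) := by
    push_cast
    refine Finset.sum_congr rfl fun i _ => ?_
    rw [EuclideanSpace.complexify_apply]
  have hinner : ⟪p, (1 / ‖latticeVec m‖) • latticeVec m⟫_ℝ = (1 / ‖latticeVec m‖) * ∑ i, (m i : ℝ) * p i := by
    rw [real_inner_smul_right]
    congr 1
    rw [PiLp.inner_apply]
    refine Finset.sum_congr rfl fun i _ => ?_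
    simp [latticeVec_apply]
  have hn0 : 0 < ‖latticeVec m‖ := lt_of_lt_of_le one_pos (one_le_norm_latticeVec hm)
  rw [hsum, Complex.norm_real, Real.norm_eq_abs, sq_abs, hinner, ← norm_latticeVec_sq, mul_pow]
  field_simp

/-- **`slotGain` in projection form**: for `q = ℓ/|ℓ|`-type unit directions and a real `p ⊥ q`,
`slotGain P q p = τ·(1/(2(2π|m|)⁴))·⟪ê, q⟫²·‖Π_m (complexify p)‖²`. -/
theorem slotGain_eq_proj (P : LatticePhase) (q p : EuclideanSpace ℝ (Fin 3)) (hpq : ⟪p, q⟫_ℝ = 0) :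
    slotGain P q p = P.τ * (1 / (2 * (2 * Real.pi * ‖latticeVec P.m‖) ^ 4)) * ⟪P.e, q⟫_ℝ ^ 2 *
      ‖Torus.leraySym P.m (EuclideanSpace.complexify p)‖ ^ 2 := by
  rw [norm_sq_leraySym_complexify P.m_ne]
  simp only [slotGain]
  have : ⟪p, (1 / ‖latticeVec P.m‖) • latticeVec P.m - ⟪(1 / ‖latticeVec P.m‖) • latticeVec P.m, q⟫_ℝ • q⟫_ℝ =
      ⟪p, (1 / ‖latticeVec P.m‖) • latticeVec P.m⟫_ℝ := by
    rw [inner_sub_right, real_inner_smul_right, real_inner_smul_right, hpq, mul_zero, sub_zero]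
  rw [this]

/-! ## §3 Isotropy in projection form for a complex slow vector -/

/-- **Isotropy in Leray-projection form.** If `IsotropicWordGain W c₀` and `ℓ ≠ 0`, then for every `b ∈ ℂ³` with
`Σ ℓᵢ bᵢ = 0`: `Σ_j τ_j·(1/(2(2π|m_j|)⁴))·(Σᵢ ê_j,ᵢ ℓᵢ)²·‖Π_{m_j} b‖² = c₀·period·|ℓ|²·‖b‖²`. -/
theorem isotropic_proj_sum (W : LatticeWord k₀) {c₀ : ℝ} (hW : IsotropicWordGain W c₀) {ℓ : Fin 3 → ℤ} (hℓ : ℓ ≠ 0)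
    (b : EuclideanSpace ℂ (Fin 3)) (hb : ∑ i, (ℓ i : ℂ) * b i = 0) :
    ∑ j, (W.phase j).τ * (1 / (2 * (2 * Real.pi * ‖latticeVec (W.phase j).m‖) ^ 4)) *
        (∑ i, (W.phase j).e i * (ℓ i : ℝ)) ^ 2 * ‖Torus.leraySym (W.phase j).m b‖ ^ 2 =
      c₀ * W.period * freqNormSq ℓ * ‖b‖ ^ 2 := by
  set A : ℝ := ‖latticeVec ℓ‖ with hA
  have hA0 : 0 < A := lt_of_lt_of_le one_pos (one_le_norm_latticeVec hℓ)
  set q : EuclideanSpace ℝ (Fin 3) := (1 / A) • latticeVec ℓ with hq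
  have hq1 : ‖q‖ = 1 := by rw [hq, norm_smul, Real.norm_eq_abs, abs_of_pos (by positivity), ← hA]; field_simp
  set bR : EuclideanSpace ℝ (Fin 3) := WithLp.toLp 2 fun i => (b i).re with hbR
  set bI : EuclideanSpace ℝ (Fin 3) := WithLp.toLp 2 fun i => (b i).im with hbI
  -- real and imaginary parts are `⊥ q`
  have hsumR : ∑ i, (ℓ i : ℝ) * bR i = 0 := by
    have := congrArg Complex.re hb
    simpa [Complex.re_sum, hbR] using this
  have hsumI : ∑ i, (ℓ i : ℝ) * bI i = 0 := by
    have := congrArg Complex.im hb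
    simpa [Complex.im_sum, hbI] using this
  have hinner : ∀ p : EuclideanSpace ℝ (Fin 3), ⟪p, q⟫_ℝ = (1 / A) * ∑ i, (ℓ i : ℝ) * p i := by
    intro p
    rw [hq, real_inner_smul_right]
    congr 1
    rw [PiLp.inner_apply]
    refine Finset.sum_congr rfl fun i _ => ?_
    simp [latticeVec_apply]
  have hRq : ⟪bR, q⟫_ℝ = 0 := by rw [hinner, hsumR, mul_zero]
  have hIq : ⟪bI, q⟫_ℝ = 0 := by rw [hinner, hsumI, mul_zero]
  -- `⟪ê_j, q⟫² = (Σ ê_j,i ℓ_i)²/|ℓ|²`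
  have he : ∀ j, ⟪(W.phase j).e, q⟫_ℝ ^ 2 * A ^ 2 = (∑ i, (W.phase j).e i * (ℓ i : ℝ)) ^ 2 := by
    intro j
    have : ⟪(W.phase j).e, q⟫_ℝ = (1 / A) * ∑ i, (W.phase j).e i * (ℓ i : ℝ) := by
      rw [hinner]
      congr 1
      refine Finset.sum_congr rfl fun i _ => ?_
      ring
    rw [this]; field_simp
  have hAf : freqNormSq ℓ = A ^ 2 := (norm_latticeVec_sq ℓ).symm
  -- sum for the two real parts
  have hR := isotropicWordGain_norm_sq hW q bR hq1 hRq
  have hI := isotropicWordGain_norm_sq hW q bI hq1 hIq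
  simp_rw [slotGain_eq_proj _ q bR hRq] at hR
  simp_rw [slotGain_eq_proj _ q bI hIq] at hI
  have hb2 : ‖b‖ ^ 2 = ‖bR‖ ^ 2 + ‖bI‖ ^ 2 := by
    conv_lhs => rw [eq_complexify_re_add_im b]
    rw [norm_sq_complexify_add_I_smul]
  calc ∑ j, (W.phase j).τ * (1 / (2 * (2 * Real.pi * ‖latticeVec (W.phase j).m‖) ^ 4)) *
        (∑ i, (W.phase j).e i * (ℓ i : ℝ)) ^ 2 * ‖Torus.leraySym (W.phase j).m b‖ ^ 2
      = A ^ 2 * (∑ j, (W.phase j).τ * (1 / (2 * (2 * Real.pi * ‖latticeVec (W.phase j).m‖) ^ 4)) *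
          ⟪(W.phase j).e, q⟫_ℝ ^ 2 * ‖Torus.leraySym (W.phase j).m (EuclideanSpace.complexify bR)‖ ^ 2 +
        ∑ j, (W.phase j).τ * (1 / (2 * (2 * Real.pi * ‖latticeVec (W.phase j).m‖) ^ 4)) *
          ⟪(W.phase j).e, q⟫_ℝ ^ 2 * ‖Torus.leraySym (W.phase j).m (EuclideanSpace.complexify bI)‖ ^ 2) := by
        rw [← Finset.sum_add_distrib, Finset.mul_sum]
        refine Finset.sum_congr rfl fun j _ => ?_
        rw [norm_sq_leraySym_re_add_im, ← he j]
        ring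
    _ = A ^ 2 * (c₀ * W.period * ‖bR‖ ^ 2 + c₀ * W.period * ‖bI‖ ^ 2) := by rw [hR, hI]
    _ = c₀ * W.period * freqNormSq ℓ * ‖b‖ ^ 2 := by rw [hAf, hb2]; ring

end Summit.AnomalousDissipation.AnomalousDissipation.Theorems.QuasiStaticSolenoidalCellTensorQ.Negative

end
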